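import Summits.HodgeConjecture.HodgeConjecture.Theorems.R90S6LatticeInvPolarity   -- ★ p10 L1 F2 `qsInvolution_mem_glInt` (brings ★ L1 F1 `R90S6LatticeInvCalculus`: `relPos`, `relPos_eq_iff`, `relPos_eq_iff_latt`; ★ W9 `R90S6TwistedPolarity`: `mapGL_qsInvolution_stdLattice`)
import Summits.HodgeConjecture.HodgeConjecture.Theorems.R90S6GLCosetLattice       -- ★ W7-f `glCosetEquivLatt` (`GL_N(K) ⧸ GL_N(𝒪) ≃` framed lattices), `glCosetEquivLatt_apply_coe`
import Mathlib.GroupTheory.DoubleCoset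
import HarnessLib

/-!
# R90 · S6 «Ch. 14.1–14.5 stable trace formula» — card J2′ (row E1.4.4.2.2, layer 1½): THE TWISTED SHELL ↔ LATTICE DICTIONARY
# `#{yK : y⁻¹ δ Θ(y) ∈ K ϖ^a K} = #{Λ : some frame h of Λ has h·ϖ^a·𝒪^N = δ·Λ^♯}` (`Theorems/R90S6TwistedShellLatticeDict.lean`)

The `GL_N` ∕ ε-twisted twin of ★ (J2) `R90.S6.ncard_quotient_shell_eq_ncard_selfDual_displaced` (W8-j, U(3) tree reading), for the twisted shell that
★ J1′ `R90.S6.epsOrbitalIntegral_indicator_quotientMeasure_eq_mul_ncard_shell` (`Theorems/R90S6TwistedOrbitalIndicatorCount.lean`) counts: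
`Φ_ε(δ, 1_S; ν∕t) = ν(K) · #{q ∈ G ⧸ K : q.out⁻¹ δ ε(q.out) ∈ S}`.  Here `G = GL_N(K)` over a discretely valued field (`Valued K ℤᵐ⁰` + compatible
`ValuativeRel K`, uniformizing element `ϖ`, `𝒪 = 𝒪[K]` a DVR — the currency of ★ p10 L1 `R90S6LatticeInvCalculus` and ★ W7-f), `K = GL_N(𝒪) = glInt N K`,
`ε = Θ_σ = UnitaryGroup.qsInvolution σ` (the quasi-split involution `g ↦ w⁰ ᵗ(σg)⁻¹ w⁰`, ★ `U3LocalBruhatDecompositionProofs`), and `S = K ϖ^a K` a Cartan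
shell (`a : Fin N → ℤ` ANTITONE — load-bearing: for unsorted `a` the shell `K ϖ^a K = K ϖ^{sort a} K` is inhabited while `relPos = sort a ≠ a`):

* §0 `twistedConj_mem_doubleCoset_iff` — the Cartan shell is invariant under twisted `K`-conjugation `g ↦ k g Θ(k)⁻¹` (J1′'s binder `hSK` at Hecke
  shells; uses ★ p10 `qsInvolution_mem_glInt`);
* §1 `inv_mul_mem_doubleCoset_iff_relPos_eq` (`g⁻¹g′ ∈ K ϖ^a K ⟺ relPos g g′ = a`) and its twisted reading
  **`inv_mul_mul_qsInvolution_mem_doubleCoset_iff_relPos`** (`q.out⁻¹ δ Θ(q.out) ∈ K ϖ^a K ⟺ relPos q.out (δ Θ q.out) = a`);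
* §2 `latt_mul_qsInvolution` — `(δ Θ_σ g)·𝒪^N = δ·(g·𝒪^N)^♯` (★ W9-b `mapGL_qsInvolution_stdLattice` of R90-C14-p03 read through ★ `mapGL_latt` ∕ `latt_one`;
  the twisted polar `P_δ Λ = δ·Λ^♯` of row E1.4.3.1.2);
* §3 HEAD **`ncard_twistedShell_eq_ncard_latt_relPos_dual`** —
  `#{q ∈ GL_N(K) ⧸ GL_N(𝒪) : q.out⁻¹ δ Θ(q.out) ∈ K ϖ^a K} = #{Λ = g·𝒪^N : ∃ h, h·𝒪^N = Λ ∧ h·ϖ^a·𝒪^N = δ·Λ^♯}` (`Set.ncard`, both sides `0` together when infinite),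
  transported along ★ W7-f `glCosetEquivLatt` (`qK ↦ q.out·𝒪^N`); the right side is the LATTICE predicate of ★ `relPos_eq_iff_latt` at the pair `(Λ, P_δ Λ)`.

With J1′ (orbital integral → coset count) and this file (coset count → lattice count), the unfolded twisted orbital integral
`TO_δ(1_{Kϖ^aK}) = ν(K) · #{Λ : inv(Λ, δ·Λ^♯) = a}` is a statement about `𝒪`-lattices in given relative position to their `δ`-twisted dual — the input
that row E1.4.4.2.2 layer 2 (apartment ∕ tube counts on the `GL₃` lattice complex) evaluates ([Kottwitz1986BaseChangeUnits] §1 pp. 239–242, §3).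

Cell `hodgecm-mathlib`, crux H413 (`stmt-HodgeConjecture-24833`), route of record `HCCMUnconditional`; programme R90-TF, section S6 (base `R90-C14`,
dealer R90-C14-plan (g2), card J2′ 2026-09-05T00:24:59Z), seat R90-C14-p08 (g0).  Lane `--kind proof --supports stmt-HodgeConjecture-24833 --as helper`;
THEOREMS ONLY over ★ `Theorems` ∕ Literature carriers (no definition, no instance, no notation, no named fact, no kit, no `sorry`).
HONEST LABEL: dictionary lemma, count-neutral until E1.4.4.2.3 consumes it; proves no printed global statement, discharges no citation; HC_CM is proved only
modulo the 7 printed citations (2 remaining named inputs: hLiu418 = stmt-HodgeConjecture-24832, h413 = stmt-HodgeConjecture-24833) until rung 0 closes.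

## References
* [Kottwitz1986BaseChangeUnits] R. E. Kottwitz, *Base change for unit elements of Hecke algebras*, Compositio Math. 60 (1986): §1 pp. 239–242 (`X_L`, the
  twisted action `g K_L ↦ δ σ(g) K_L`, «inv»), §3.
* [Macdonald1995] I. G. Macdonald, *Symmetric Functions and Hall Polynomials*, 2nd ed. (1995): Ch. V §2 (2.2)–(2.6) (relative position of lattices,
  `G ∕ K` = lattices).
* [Rogawski1990] J. D. Rogawski, *Automorphic Representations of Unitary Groups in Three Variables* (1990): §1.9–§1.10 pp. 8–9 (`Θ`, `w⁰`), §4.10 p. 57.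
-/

set_option autoImplicit false
-- the mandated namespace repeats the single-problem summit's segment (`HodgeConjecture.HodgeConjecture`)
set_option linter.dupNamespace false

noncomputable section

open scoped Valued WithZero Matrix MatrixGroups Pointwise
open Literature.NumberTheory.Automorphic Literature.NumberTheory.Automorphic.HermitianLattice Literature.NumberTheory.Automorphic.UnitaryLatticeTree

namespace Summit.HodgeConjecture.HodgeConjecture.R90.S6

/-! ## §0 The Cartan shell `K d K` is invariant under twisted `K`-conjugation -/

section Shell

variable {K : Type*} [Field K] [Valued K ℤᵐ⁰] [ValuativeRel K] [(Valued.v : Valuation K ℤᵐ⁰).Compatible] {σ : K →+* K} {N : ℕ}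

omit [Valued K ℤᵐ⁰] [(Valued.v : Valuation K ℤᵐ⁰).Compatible] in
/-- A double coset `K d K` (`K = GL_N(𝒪)`) is bi-`K`-invariant: `x g y ∈ K d K ↔ g ∈ K d K` for `x, y ∈ K`. [cite: Macdonald1995, Ch. V §2 (2.6)] -/
theorem mul_mul_mem_doubleCoset_iff (d : GL (Fin N) K) {x y : GL (Fin N) K} (hx : x ∈ glInt N K) (hy : y ∈ glInt N K) (g : GL (Fin N) K) :
    x * g * y ∈ (glInt N K : Set (GL (Fin N) K)) * {d} * (glInt N K : Set (GL (Fin N) K)) ↔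
      g ∈ (glInt N K : Set (GL (Fin N) K)) * {d} * (glInt N K : Set (GL (Fin N) K)) := by
  change x * g * y ∈ DoubleCoset.doubleCoset d (glInt N K : Set (GL (Fin N) K)) (glInt N K) ↔
    g ∈ DoubleCoset.doubleCoset d (glInt N K : Set (GL (Fin N) K)) (glInt N K)
  rw [DoubleCoset.mem_doubleCoset, DoubleCoset.mem_doubleCoset]
  constructor
  · rintro ⟨k₁, hk₁, k₂, hk₂, e⟩
    refine ⟨x⁻¹ * k₁, (glInt N K).mul_mem ((glInt N K).inv_mem hx) hk₁, k₂ * y⁻¹, (glInt N K).mul_mem hk₂ ((glInt N K).inv_mem hy), ?_⟩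
    calc g = x⁻¹ * (x * g * y) * y⁻¹ := by group
      _ = x⁻¹ * k₁ * d * (k₂ * y⁻¹) := by rw [e]; group
  · rintro ⟨k₁, hk₁, k₂, hk₂, rfl⟩
    exact ⟨x * k₁, (glInt N K).mul_mem hx hk₁, k₂ * y, (glInt N K).mul_mem hk₂ hy, by group⟩

/-- **J1′'s binder `hSK` at the Hecke shells**: for `σ` valuation-preserving (so `Θ_σ(GL_N(𝒪)) ⊆ GL_N(𝒪)`, ★ `qsInvolution_mem_glInt`), the double coset
`GL_N(𝒪)·d·GL_N(𝒪)` is invariant under the twisted `GL_N(𝒪)`-conjugation `g ↦ k g Θ_σ(k)⁻¹`. [cite: Kottwitz1986BaseChangeUnits, §1 p. 239] -/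
theorem twistedConj_mem_doubleCoset_iff (hvσ : ∀ a, Valued.v (σ a) = Valued.v a) (d : GL (Fin N) K) :
    ∀ k : GL (Fin N) K, k ∈ glInt N K → ∀ g : GL (Fin N) K,
      k * g * (UnitaryGroup.qsInvolution σ k)⁻¹ ∈ (glInt N K : Set (GL (Fin N) K)) * {d} * (glInt N K : Set (GL (Fin N) K)) ↔
        g ∈ (glInt N K : Set (GL (Fin N) K)) * {d} * (glInt N K : Set (GL (Fin N) K)) :=
  fun _ hk g => mul_mul_mem_doubleCoset_iff d hk ((glInt N K).inv_mem (qsInvolution_mem_glInt hvσ hk)) g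

end Shell

/-! ## §1 Shell membership ⟷ relative position -/

section RelPos

variable {K : Type*} [Field K] [Valued K ℤᵐ⁰] [ValuativeRel K] [(Valued.v : Valuation K ℤᵐ⁰).Compatible] {σ : K →+* K} {N : ℕ}
  [IsDiscreteValuationRing (ValuativeRel.valuation K).integer] {ϖ : K} (hϖ : IsUniformizingElement ϖ)
include hϖ

omit [Valued K ℤᵐ⁰] [(Valued.v : Valuation K ℤᵐ⁰).Compatible] in
/-- **`g⁻¹g′ ∈ GL_N(𝒪)·ϖ^a·GL_N(𝒪) ⟺ relPos hϖ g g′ = a`** for an ANTITONE exponent vector `a` (★ `relPos_eq_iff`, the `∃ k₁ k₂` form, read as membership in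
the pointwise product set `K·{ϖ^a}·K` = Mathlib `DoubleCoset.doubleCoset`). [cite: Macdonald1995, Ch. V §2 (2.2), (2.6)] -/
theorem inv_mul_mem_doubleCoset_iff_relPos_eq {a : Fin N → ℤ} (ha : Antitone a) (g g' : GL (Fin N) K) :
    g⁻¹ * g' ∈ (glInt N K : Set (GL (Fin N) K)) * {zpowDiagGL hϖ.ne_zero a} * (glInt N K : Set (GL (Fin N) K)) ↔ relPos hϖ g g' = a := by
  change g⁻¹ * g' ∈ DoubleCoset.doubleCoset (zpowDiagGL hϖ.ne_zero a) (glInt N K : Set (GL (Fin N) K)) (glInt N K) ↔ _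
  rw [DoubleCoset.mem_doubleCoset, relPos_eq_iff]
  constructor
  · rintro ⟨k₁, hk₁, k₂, hk₂, e⟩
    refine ⟨ha, k₁⁻¹, (glInt N K).inv_mem hk₁, k₂⁻¹, (glInt N K).inv_mem hk₂, ?_⟩
    rw [e]
    group
  · rintro ⟨-, k₁, hk₁, k₂, hk₂, e⟩
    refine ⟨k₁⁻¹, (glInt N K).inv_mem hk₁, k₂⁻¹, (glInt N K).inv_mem hk₂, ?_⟩
    rw [← e]
    group

omit [Valued K ℤᵐ⁰] [(Valued.v : Valuation K ℤᵐ⁰).Compatible] in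
/-- **THE TWISTED SHELL CONDITION AS A RELATIVE POSITION**: for `q ∈ GL_N(K) ⧸ GL_N(𝒪)`, `δ ∈ GL_N(K)` and `a` antitone,
`q.out⁻¹ · δ · Θ_σ(q.out) ∈ GL_N(𝒪)·ϖ^a·GL_N(𝒪) ⟺ relPos hϖ q.out (δ Θ_σ q.out) = a` — the predicate counted by ★ J1′
`epsOrbitalIntegral_indicator_quotientMeasure_eq_mul_ncard_shell` at `S = K ϖ^a K`, `ε = Θ_σ` (the `∃ k₁ k₂`∕lattice-frame twin is ★ W9-c
`R90.S6.twistedRelPosition_iff_mem_doubleCoset`, R90-C14-p10). [cite: Kottwitz1986BaseChangeUnits, §1 p. 240] [cite: Macdonald1995, Ch. V §2 (2.6)] -/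
theorem inv_mul_mul_qsInvolution_mem_doubleCoset_iff_relPos {a : Fin N → ℤ} (ha : Antitone a) (δ : GL (Fin N) K)
    (q : GL (Fin N) K ⧸ glInt N K) :
    q.out⁻¹ * δ * UnitaryGroup.qsInvolution σ q.out ∈
        (glInt N K : Set (GL (Fin N) K)) * {zpowDiagGL hϖ.ne_zero a} * (glInt N K : Set (GL (Fin N) K)) ↔
      relPos hϖ q.out (δ * UnitaryGroup.qsInvolution σ q.out) = a := by
  rw [show q.out⁻¹ * δ * UnitaryGroup.qsInvolution σ q.out = q.out⁻¹ * (δ * UnitaryGroup.qsInvolution σ q.out) from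
    mul_assoc _ _ _]
  exact inv_mul_mem_doubleCoset_iff_relPos_eq hϖ ha q.out _

end RelPos

/-! ## §2 The twisted polar of a framed lattice: `(δ Θ_σ g)·𝒪^N = δ·(g·𝒪^N)^♯` -/

section Polar

variable {K : Type*} [Field K] [Valued K ℤᵐ⁰] {σ : K →+* K} {N : ℕ}

/-- **`latt (δ Θ_σ g) = δ·(latt g)^♯`** — the coset `(δ Θ_σ g)·GL_N(𝒪)` is the twisted polar `P_δ Λ = δ·Λ^♯` of `Λ = g·𝒪^N` (`^♯` the `J₀ = w⁰`-dual): ★ W9-b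
`mapGL_qsInvolution_stdLattice` (`Θ_σ(g)·𝒪^N = (g·𝒪^N)^♯`, R90-C14-p03) read through ★ `latt_one` ∕ ★ `mapGL_latt`.
[cite: Kottwitz1986BaseChangeUnits, §1 p. 240] [cite: Rogawski1990, §1.9–§1.10 pp. 8–9] -/
theorem latt_mul_qsInvolution (hvσ : ∀ a, Valued.v (σ a) = Valued.v a) (δ g : GL (Fin N) K) :
    latt ((δ * UnitaryGroup.qsInvolution σ g : GL (Fin N) K) : Matrix (Fin N) (Fin N) K) =
      mapGL δ (dualLatt σ ((StdForm.antidiagonal N).over K) (latt ((g : GL (Fin N) K) : Matrix (Fin N) (Fin N) K))) := by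
  have h := mapGL_qsInvolution_stdLattice hvσ g
  rw [← latt_one, ← Units.val_one, mapGL_latt, mapGL_latt, mul_one, mul_one] at h
  rw [← mapGL_latt, h]

end Polar

/-! ## §3 The count: twisted shell cosets ⟷ lattices in position `a` to their twisted polar -/

section Count

variable {K : Type*} [Field K] [Valued K ℤᵐ⁰] [ValuativeRel K] [(Valued.v : Valuation K ℤᵐ⁰).Compatible] {σ : K →+* K} {N : ℕ}
  [IsDiscreteValuationRing (ValuativeRel.valuation K).integer] {ϖ : K} (hϖ : IsUniformizingElement ϖ)
include hϖ

/-- **J2′ HEAD — THE TWISTED SHELL ↔ LATTICE DICTIONARY.**  For `σ` valuation-preserving, `δ ∈ GL_N(K)` and an antitone `a : Fin N → ℤ`: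
`#{q ∈ GL_N(K) ⧸ GL_N(𝒪) : q.out⁻¹ δ Θ_σ(q.out) ∈ GL_N(𝒪)·ϖ^a·GL_N(𝒪)} = #{Λ = g·𝒪^N : ∃ h, h·𝒪^N = Λ ∧ h·ϖ^a·𝒪^N = δ·Λ^♯}` (`Set.ncard`; the right side is the
LATTICE predicate «`inv(Λ, P_δ Λ) = a`» of ★ `relPos_eq_iff_latt` at the pair `(Λ, δ·Λ^♯)`).  Transport along ★ W7-f `glCosetEquivLatt` (`qK ↦ q.out·𝒪^N`):
pointwise `q.out⁻¹ δ Θ(q.out) ∈ Kϖ^aK ⟺ relPos q.out (δ Θ q.out) = a` (§1) `⟺ ∃ h, latt h = latt q.out ∧ latt (h ϖ^a) = latt (δ Θ q.out)` (★ `relPos_eq_iff_latt`)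
and `latt (δ Θ q.out) = δ·(latt q.out)^♯` (§2), `latt q.out = glCosetEquivLatt q`.  With ★ J1′: `TO_δ(1_{Kϖ^aK}) = ν(K) · #{Λ : inv(Λ, δ·Λ^♯) = a}`.
[cite: Kottwitz1986BaseChangeUnits, §1 pp. 239–242] [cite: Macdonald1995, Ch. V §2 (2.6)] -/
theorem ncard_twistedShell_eq_ncard_latt_relPos_dual (hvσ : ∀ a, Valued.v (σ a) = Valued.v a) {a : Fin N → ℤ} (ha : Antitone a)
    (δ : GL (Fin N) K) :
    {q : GL (Fin N) K ⧸ glInt N K |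
        q.out⁻¹ * δ * UnitaryGroup.qsInvolution σ q.out ∈
          (glInt N K : Set (GL (Fin N) K)) * {zpowDiagGL hϖ.ne_zero a} * (glInt N K : Set (GL (Fin N) K))}.ncard =
      {M : {M : Submodule 𝒪[K] (Fin N → K) // ∃ g : GL (Fin N) K, M = latt (g : Matrix (Fin N) (Fin N) K)} |
        ∃ h : GL (Fin N) K, latt (h : Matrix (Fin N) (Fin N) K) = M.1 ∧
          latt ((h * zpowDiagGL hϖ.ne_zero a : GL (Fin N) K) : Matrix (Fin N) (Fin N) K) =
            mapGL δ (dualLatt σ ((StdForm.antidiagonal N).over K) M.1)}.ncard := by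
  refine Set.ncard_congr' (glCosetEquivLatt.subtypeEquiv fun q => ?_)
  -- pointwise: the shell condition at `q.out` ⟷ the lattice predicate at `q.out·𝒪^N = glCosetEquivLatt q`
  have hq : ((glCosetEquivLatt q : {M : Submodule 𝒪[K] (Fin N → K) // ∃ g : GL (Fin N) K, M = latt (g : Matrix (Fin N) (Fin N) K)}) :
      Submodule 𝒪[K] (Fin N → K)) = latt ((q.out : GL (Fin N) K) : Matrix (Fin N) (Fin N) K) := by
    conv_lhs => rw [← QuotientGroup.out_eq' q]
    exact glCosetEquivLatt_apply_coe q.out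
  change q.out⁻¹ * δ * UnitaryGroup.qsInvolution σ q.out ∈
      (glInt N K : Set (GL (Fin N) K)) * {zpowDiagGL hϖ.ne_zero a} * (glInt N K : Set (GL (Fin N) K)) ↔
    ∃ h : GL (Fin N) K, latt (h : Matrix (Fin N) (Fin N) K) =
        ((glCosetEquivLatt q : {M : Submodule 𝒪[K] (Fin N → K) // ∃ g : GL (Fin N) K, M = latt (g : Matrix (Fin N) (Fin N) K)}) :
          Submodule 𝒪[K] (Fin N → K)) ∧
      latt ((h * zpowDiagGL hϖ.ne_zero a : GL (Fin N) K) : Matrix (Fin N) (Fin N) K) =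
        mapGL δ (dualLatt σ ((StdForm.antidiagonal N).over K)
          ((glCosetEquivLatt q : {M : Submodule 𝒪[K] (Fin N → K) // ∃ g : GL (Fin N) K, M = latt (g : Matrix (Fin N) (Fin N) K)}) :
            Submodule 𝒪[K] (Fin N → K)))
  rw [hq, inv_mul_mul_qsInvolution_mem_doubleCoset_iff_relPos hϖ ha δ q, relPos_eq_iff_latt hϖ, ← latt_mul_qsInvolution hvσ δ q.out]
  exact ⟨fun h => h.2, fun h => ⟨ha, h⟩⟩

end Count

end Summit.HodgeConjecture.HodgeConjecture.R90.S6

end
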